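/-
Copyright: public-domain mathematics; typed transcription for the H21 Literature library (cell lit-balaban,
Phase-2 proof seat p27 gen 7 = literature-prover-lit-balaban-p27-g7-0).

statement-level skeleton of published theorems with citation tags; proofs where landed; nothing here is a claim about the Yang–Mills mass gap

# Bałaban, *Propagators and renormalization transformations for lattice gauge theories. I*,
# Commun. Math. Phys. **95** (1984) 17–40 — the p. 36 route «e^{−⟨q,x⟩}Δ_a e^{⟨q,x⟩} − Δ_a is a small perturbation
# of Δ_a» FOR OPERATORS WITH A NON-LOCAL PART: the exponential conjugation of an exponentially decaying kernel
# ((1.126)-shape ⇒ an O(δ) defect), the weighted solve for `Δ_a = Λ − K`, and the localisation step of (1.114)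

[cite: Balaban1984PropagatorsI]  T. Bałaban, Commun. Math. Phys. 95 (1984) 17–40.  p. 36 (PDF p. 20), verbatim: «Probably the
simplest proof of the exponential decay properties can be obtained by relating G on the torus to G on the whole lattice ηZ^d in
the usual way, and then proving that the operator e^{−⟨q,x⟩}Δ_a e^{⟨q,x⟩} − Δ_a is a small perturbation of Δ_a for vectors
q ∈ R^d sufficiently small.»; p. 29 (1.69) `Δ_a = Δ − ∂P∂* + aQ*Q`; p. 33 (1.90) `Δ_a = G⁻¹ ≥ γ₀(Δ + I)`; p. 36 (1.114) (the six
localised L² bounds); p. 38 (1.126) `|(∂P∂*)_{μ,ν}(x, x′)| ≤ O(1)e^{−δ′₀|x−x′|}` with the kernel convention (1.120) p. 37.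

PDF held: `paper:balaban1984-cmp95-propagators-rt-i` (journal page = PDF page + 16).

WHY (SKELETON row **B5.Prop1.2**, owner r02's census item **(vi)-G** = `B5.Local114Fam fam` for the G-setting of record, «candidate
method = p38's exponential-weight conjugation applied to Δ_a = Δ − ∂P∂* + aQ*Q using the (1.126) decay of the non-local part»,
ROWS-B5 v2.61; lit-balaban HOME `run/shared/lean/pub/lit-balaban/`).  p38 gen 5 ran the p. 36 route for the LOCAL operator
G₀⁻¹ = Δ + aQ*Q (`B5CombesThomasTorus.conjM0_ge`/`solve_bound`): the first-order conjugation terms of a local symmetric stencil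
cancel and the defect is O(δ²).  For G = Δ_a⁻¹ the operator has the NON-LOCAL symmetric part `−∂P∂*`, whose only printed
property is the kernel decay (1.126).  This module supplies the missing generic step and the assembly:
* §1 `|e^s − 1| ≤ |s|e^{|s|}` and bookkeeping of double sums;
* §2 **`kernel_conj_defect_le`** — for a symmetric kernel `K` on any finite carrier, a symmetric pseudo-distance `d`, a
  `d`-Lipschitz exponent `ρ` and `0 ≤ δ ≤ δ₁`:  `|⟨e^{δρ}u, K e^{−δρ}u⟩ − ⟨u, Ku⟩| ≤ δ·S·‖u‖²`, where
  `S ≥ sup_x Σ_{x′}|K(x,x′)|·d(x,x′)e^{δ₁d(x,x′)}` is the (1.126)-type row profile (for `|K(x,x′)| ≤ Cη^d e^{−δ′₀|x−x′|}`,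
  `δ₁ < δ′₀`, this profile is a lattice sum uniform in η and in the volume);
* §3 **`weighted_solve`** — for `Δ_a = Λ − K` with the coercivity (1.90)-shape `γ(Σ_i‖D_iu‖² + ‖u‖²) ≤ ⟨u, Δ_au⟩`, a local part
  obeying p38's conjugation shape `⟨u,Λu⟩ − c_Λ‖u‖² ≤ ⟨wu, Λ(w⁻¹u)⟩` and a non-local part with defect `≤ c_K‖u‖²`,
  `c_Λ + c_K ≤ γ/2`:  for `v = Gg` (`Δ_aG = 1`) and `u = wv`,  `Σ_i‖D_iu‖² + ‖u‖² ≤ (2/γ)²‖wg‖²` — p38's `solve_bound` with the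
  kernel term; and the form lower bound `conj_form_ge`;
* §4 the LOCALISATION step of (1.114): `weight_mul_eq_self` (`e^{δρ}g = g` when ρ vanishes on supp g) and
  **`sum_sq_filter_le_exp`** (`Σ_{ρ ≥ R} v² ≤ e^{−2δR}‖e^{δρ}v‖²`), **`local_decay`** (the two combined with §3: the n = 0 member
  shape `Σ_{x : ρ(x) ≥ R}(Gg)(x)² ≤ e^{−2δR}(2/γ)²‖g‖²`);
* §5 THE TOWER INSTANCE (one component): on p37's carrier `Site P 0`, `Λ = M0 P a m² k μ` (= −Δ^η + (Lᵏε)²m² + aQ*_μQ_μ, whose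
  conjugation shape IS p38's `conjM0_ge`), `K` any symmetric kernel with a `distX`-row profile, `Δ_a := M0 − K` coercive in the
  (1.90) shape: **`solve_bound_kernel`** (`dirE(wGg) + nsq(wGg) ≤ (2/γ)²nsq(wg)` for `4δ ≤ 1`, `δ ≤ δ₁`,
  `(2d + 16a)δ² + δS ≤ γ/2`) and **`local_decay_kernel`**.

HONEST SCOPE.  This is the generic half of census item (vi)-G, not (vi)-G: the instantiation on the G-setting of record
(`B5SettingP12Real.latticeSettingP12R`, operator `B5DeltaA169.DeltaA`) needs (a) the identification of the position-space kernel
of `GradOp·PcT·GradOpᴴ` with the (1.126)-certified `B5DPD126Uniform.dpd` (r02's memo (c)) to discharge the row profile, and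
(b) the conjugation shape for `Lap + aQ*Q` in that typing (p38's `conjM0_ge` is its tower form); the members n = 1…4 of (1.114)
then follow the pattern of `B5Local114G0First/Second` from `weighted_solve`'s derivative term.  §5 is a ONE-COMPONENT model
(Δ + aQ*Q is direction-diagonal; the true ∂P∂* couples directions — the vector version is the same proof on `Fin d × Site P 0`).
The defect bound is O(δ) (first order, no symmetrisation), which suffices for «q sufficiently small».  No new definition, no
new named fact; nothing here is summit progress.
-/
import Mathlib
import Literature.MathematicalPhysics.QuantumFieldTheory.Balaban1983to89.B5CombesThomasTorus

open scoped BigOperators Matrix Real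
open Finset Matrix

namespace Literature.MathematicalPhysics.QuantumFieldTheory.Balaban1983to89.B5CombesThomasKernel

open Literature.MathematicalPhysics.QuantumFieldTheory.Balaban1983to89

noncomputable section

/-! ## §1 Elementary facts -/

/-- `|e^s − 1| ≤ |s|·e^{|s|}`. [folklore] -/
private theorem abs_exp_sub_one_le (s : ℝ) : |Real.exp s - 1| ≤ |s| * Real.exp |s| := by
  rcases le_or_gt 0 s with hs | hs
  · have h0 : 0 ≤ Real.exp s - 1 := by linarith [Real.add_one_le_exp s]
    rw [abs_of_nonneg h0, abs_of_nonneg hs]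
    have h1 : -s + 1 ≤ Real.exp (-s) := Real.add_one_le_exp (-s)
    have h2 : (-s + 1) * Real.exp s ≤ Real.exp (-s) * Real.exp s :=
      mul_le_mul_of_nonneg_right h1 (Real.exp_pos s).le
    rw [← Real.exp_add, neg_add_cancel, Real.exp_zero] at h2
    nlinarith [h2]
  · have h1 : s + 1 ≤ Real.exp s := Real.add_one_le_exp s
    have h2 : Real.exp s < Real.exp 0 := Real.exp_strictMono hs
    rw [Real.exp_zero] at h2
    rw [abs_of_neg (by linarith), abs_of_neg hs]
    have h3 : 1 ≤ Real.exp (-s) := Real.one_le_exp (by linarith)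
    have h4 : -s * 1 ≤ -s * Real.exp (-s) := mul_le_mul_of_nonneg_left h3 (by linarith)
    linarith

/-- `⟨f, Kg⟩ = Σ_xΣ_{x′} f(x)K(x,x′)g(x′)`. [folklore] -/
private theorem dot_mulVec_eq_sum_sum {X : Type*} [Fintype X] (K : Matrix X X ℝ) (f g : X → ℝ) :
    f ⬝ᵥ (K *ᵥ g) = ∑ x, ∑ x', f x * K x x' * g x' := by
  simp only [dotProduct, Matrix.mulVec, Finset.mul_sum, mul_assoc]

/-- `Σ_x u(x)² = u ⬝ᵥ u`. [folklore] -/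
private theorem sum_sq_eq_dot {X : Type*} [Fintype X] (u : X → ℝ) : ∑ x, u x ^ 2 = u ⬝ᵥ u := by
  simp only [dotProduct, sq]

/-- Cauchy–Schwarz: `u ⬝ᵥ v ≤ √(Σu²)·√(Σv²)`. [folklore] -/
private theorem dot_le_sqrt_mul_sqrt {X : Type*} [Fintype X] (u v : X → ℝ) :
    u ⬝ᵥ v ≤ Real.sqrt (∑ x, u x ^ 2) * Real.sqrt (∑ x, v x ^ 2) := by
  have hcs := Finset.sum_mul_sq_le_sq_mul_sq (Finset.univ : Finset X) u v
  have hA : 0 ≤ ∑ x, u x ^ 2 := Finset.sum_nonneg fun _ _ => sq_nonneg _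
  calc u ⬝ᵥ v = ∑ x, u x * v x := rfl
    _ ≤ |∑ x, u x * v x| := le_abs_self _
    _ = Real.sqrt ((∑ x, u x * v x) ^ 2) := (Real.sqrt_sq_eq_abs _).symm
    _ ≤ Real.sqrt ((∑ x, u x ^ 2) * ∑ x, v x ^ 2) := Real.sqrt_le_sqrt hcs
    _ = Real.sqrt (∑ x, u x ^ 2) * Real.sqrt (∑ x, v x ^ 2) := Real.sqrt_mul hA _

/-- from `γ/2·E ≤ √E·√N` (E, N ≥ 0, γ > 0) to `E ≤ (2/γ)²·N`. [folklore] -/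
private theorem le_of_half_gamma_mul_le {γ E N : ℝ} (hγ : 0 < γ) (hE : 0 ≤ E) (hN : 0 ≤ N)
    (h : γ / 2 * E ≤ Real.sqrt E * Real.sqrt N) : E ≤ (2 / γ) ^ 2 * N := by
  have hsE : 0 ≤ Real.sqrt E := Real.sqrt_nonneg _
  have hsN : 0 ≤ Real.sqrt N := Real.sqrt_nonneg _
  have key : Real.sqrt E ≤ 2 / γ * Real.sqrt N := by
    by_cases h0 : Real.sqrt E = 0
    · rw [h0]; positivity
    · have hpos : 0 < Real.sqrt E := lt_of_le_of_ne hsE (Ne.symm h0)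
      have h' : γ / 2 * Real.sqrt E * Real.sqrt E ≤ Real.sqrt N * Real.sqrt E := by
        rw [mul_assoc, Real.mul_self_sqrt hE]; linarith
      have h'' : γ / 2 * Real.sqrt E ≤ Real.sqrt N := le_of_mul_le_mul_right h' hpos
      rw [div_mul_eq_mul_div, le_div_iff₀ hγ]
      linarith
  have h2 : Real.sqrt E ^ 2 ≤ (2 / γ * Real.sqrt N) ^ 2 := pow_le_pow_left₀ hsE key 2
  rwa [Real.sq_sqrt hE, mul_pow, Real.sq_sqrt hN] at h2

/-! ## §2 The conjugation defect of an exponentially decaying symmetric kernel -/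

section Kernel

variable {X : Type*} [Fintype X]

omit [Fintype X] in
/-- the entrywise bound behind §2: for `|ρ(x) − ρ(x′)| ≤ d(x,x′)` and `0 ≤ δ ≤ δ₁`,
`|e^{δ(ρ(x)−ρ(x′))} − 1| ≤ δ·d(x,x′)·e^{δ₁d(x,x′)}`. [cite: Balaban1984PropagatorsI, p.36 («e^{−⟨q,x⟩}Δ_a e^{⟨q,x⟩} − Δ_a … small perturbation of Δ_a for vectors q … sufficiently small»)] -/
theorem abs_exp_ratio_sub_one_le (d : X → X → ℝ) (ρ : X → ℝ) (hρ : ∀ x x', |ρ x - ρ x'| ≤ d x x') {δ δ₁ : ℝ}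
    (hδ0 : 0 ≤ δ) (hδ1 : δ ≤ δ₁) (x x' : X) :
    |Real.exp (δ * (ρ x - ρ x')) - 1| ≤ δ * d x x' * Real.exp (δ₁ * d x x') := by
  have hd : 0 ≤ d x x' := (abs_nonneg _).trans (hρ x x')
  have hs : |δ * (ρ x - ρ x')| ≤ δ * d x x' := by
    rw [abs_mul, abs_of_nonneg hδ0]; exact mul_le_mul_of_nonneg_left (hρ x x') hδ0
  have h1 := abs_exp_sub_one_le (δ * (ρ x - ρ x'))
  have h2 : Real.exp |δ * (ρ x - ρ x')| ≤ Real.exp (δ₁ * d x x') :=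
    Real.exp_le_exp.mpr (hs.trans (mul_le_mul_of_nonneg_right hδ1 hd))
  calc |Real.exp (δ * (ρ x - ρ x')) - 1| ≤ |δ * (ρ x - ρ x')| * Real.exp |δ * (ρ x - ρ x')| := h1
    _ ≤ δ * d x x' * Real.exp (δ₁ * d x x') :=
        mul_le_mul hs h2 (Real.exp_pos _).le (mul_nonneg hδ0 hd)

/-- **THE CONJUGATION DEFECT OF A DECAYING KERNEL** — the non-local half of «e^{−⟨q,x⟩}Δ_a e^{⟨q,x⟩} − Δ_a is a small
perturbation»: for a symmetric kernel `K`, a symmetric pseudo-distance `d`, a `d`-Lipschitz exponent `ρ`, `0 ≤ δ ≤ δ₁`, and a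
row profile `Σ_{x′}|K(x,x′)|·d(x,x′)e^{δ₁d(x,x′)} ≤ S` (the shape (1.126) supplies, uniformly in η and in the volume):
`|⟨e^{δρ}u, K(e^{−δρ}u)⟩ − ⟨u, Ku⟩| ≤ δ·S·Σ_x u(x)²`.
[cite: Balaban1984PropagatorsI, p.36 («… a small perturbation of Δ_a for vectors q ∈ R^d sufficiently small») with (1.126) p.38] -/
theorem kernel_conj_defect_le (K : Matrix X X ℝ) (hK : K.IsSymm) (d : X → X → ℝ) (hd : ∀ x x', d x x' = d x' x)
    (ρ : X → ℝ) (hρ : ∀ x x', |ρ x - ρ x'| ≤ d x x') {δ δ₁ S : ℝ} (hδ0 : 0 ≤ δ) (hδ1 : δ ≤ δ₁)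
    (hS : ∀ x, ∑ x', |K x x'| * (d x x' * Real.exp (δ₁ * d x x')) ≤ S) (u : X → ℝ) :
    |(fun x => Real.exp (δ * ρ x) * u x) ⬝ᵥ (K *ᵥ fun x => (Real.exp (δ * ρ x))⁻¹ * u x) - u ⬝ᵥ (K *ᵥ u)|
      ≤ δ * S * ∑ x, u x ^ 2 := by
  -- the defect as a double sum with the factor e^{δ(ρx − ρx′)} − 1
  set b : X → X → ℝ := fun x x' => |K x x'| * (d x x' * Real.exp (δ₁ * d x x')) with hb
  have hb_symm : ∀ x x', b x x' = b x' x := by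
    intro x x'
    simp only [hb, hd x x']
    rw [show K x x' = K x' x from by rw [← hK.apply x x']]
  have hdiff : (fun x => Real.exp (δ * ρ x) * u x) ⬝ᵥ (K *ᵥ fun x => (Real.exp (δ * ρ x))⁻¹ * u x) - u ⬝ᵥ (K *ᵥ u)
      = ∑ x, ∑ x', (Real.exp (δ * (ρ x - ρ x')) - 1) * K x x' * (u x * u x') := by
    rw [dot_mulVec_eq_sum_sum, dot_mulVec_eq_sum_sum, ← Finset.sum_sub_distrib]
    refine Finset.sum_congr rfl fun x _ => ?_
    rw [← Finset.sum_sub_distrib]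
    refine Finset.sum_congr rfl fun x' _ => ?_
    have hexp : Real.exp (δ * (ρ x - ρ x')) = Real.exp (δ * ρ x) * (Real.exp (δ * ρ x'))⁻¹ := by
      rw [mul_sub, Real.exp_sub, div_eq_mul_inv]
    rw [hexp]
    ring
  rw [hdiff]
  -- termwise bound by δ·b(x,x′)·|u x||u x′| ≤ δ·b·(u x² + u x′²)/2
  have hterm : ∀ x x', |(Real.exp (δ * (ρ x - ρ x')) - 1) * K x x' * (u x * u x')|
      ≤ δ * b x x' * ((u x ^ 2 + u x' ^ 2) / 2) := by
    intro x x'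
    rw [abs_mul, abs_mul]
    have h1 := abs_exp_ratio_sub_one_le d ρ hρ hδ0 hδ1 x x'
    have h2 : |u x * u x'| ≤ (u x ^ 2 + u x' ^ 2) / 2 := by
      rw [abs_mul]
      nlinarith [sq_nonneg (|u x| - |u x'|), sq_abs (u x), sq_abs (u x')]
    have hd0 : 0 ≤ d x x' := (abs_nonneg _).trans (hρ x x')
    calc |Real.exp (δ * (ρ x - ρ x')) - 1| * |K x x'| * |u x * u x'|
        ≤ (δ * d x x' * Real.exp (δ₁ * d x x')) * |K x x'| * ((u x ^ 2 + u x' ^ 2) / 2) :=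
          mul_le_mul (mul_le_mul_of_nonneg_right h1 (abs_nonneg _)) h2 (abs_nonneg _)
            (mul_nonneg (by positivity) (abs_nonneg _))
      _ = δ * b x x' * ((u x ^ 2 + u x' ^ 2) / 2) := by simp only [hb]; ring
  have hsum : |∑ x, ∑ x', (Real.exp (δ * (ρ x - ρ x')) - 1) * K x x' * (u x * u x')|
      ≤ ∑ x, ∑ x', δ * b x x' * ((u x ^ 2 + u x' ^ 2) / 2) := by
    refine (Finset.abs_sum_le_sum_abs _ _).trans (Finset.sum_le_sum fun x _ => ?_)
    exact (Finset.abs_sum_le_sum_abs _ _).trans (Finset.sum_le_sum fun x' _ => hterm x x')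
  refine hsum.trans ?_
  -- split the symmetric double sum: Σ_xΣ_x′ b·(u_x² + u_x′²)/2 = ½ΣΣ b·u_x² + ½ΣΣ b·u_x′², each ≤ S·Σu²
  have hu : ∀ x, 0 ≤ u x ^ 2 := fun x => sq_nonneg _
  have hA : ∑ x, ∑ x', b x x' * u x ^ 2 ≤ S * ∑ x, u x ^ 2 := by
    rw [Finset.mul_sum]
    refine Finset.sum_le_sum fun x _ => ?_
    rw [← Finset.sum_mul]
    exact mul_le_mul_of_nonneg_right (hS x) (hu x)
  have hB : ∑ x, ∑ x', b x x' * u x' ^ 2 ≤ S * ∑ x, u x ^ 2 := by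
    rw [Finset.sum_comm, Finset.mul_sum]
    refine Finset.sum_le_sum fun x' _ => ?_
    have e : ∑ x, b x x' * u x' ^ 2 = (∑ x, b x' x) * u x' ^ 2 := by
      rw [Finset.sum_mul]
      exact Finset.sum_congr rfl fun x _ => by rw [hb_symm x x']
    rw [e]
    exact mul_le_mul_of_nonneg_right (hS x') (hu x')
  have e : ∑ x, ∑ x', δ * b x x' * ((u x ^ 2 + u x' ^ 2) / 2)
      = δ / 2 * ((∑ x, ∑ x', b x x' * u x ^ 2) + ∑ x, ∑ x', b x x' * u x' ^ 2) := by
    rw [← Finset.sum_add_distrib, Finset.mul_sum]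
    refine Finset.sum_congr rfl fun x _ => ?_
    rw [← Finset.sum_add_distrib, Finset.mul_sum]
    exact Finset.sum_congr rfl fun x' _ => by ring
  rw [e]
  have hδ2 : 0 ≤ δ / 2 := by linarith
  calc δ / 2 * ((∑ x, ∑ x', b x x' * u x ^ 2) + ∑ x, ∑ x', b x x' * u x' ^ 2)
      ≤ δ / 2 * (S * ∑ x, u x ^ 2 + S * ∑ x, u x ^ 2) := mul_le_mul_of_nonneg_left (add_le_add hA hB) hδ2
    _ = δ * S * ∑ x, u x ^ 2 := by ring

end Kernel

/-! ## §3 The weighted solve for `Δ_a = Λ − K` -/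

section Solve

variable {X : Type*} [Fintype X] [DecidableEq X]

omit [DecidableEq X] in
/-- **the conjugated form of `Δ_a = Λ − K` is still coercive** for small δ: from the (1.90)-shape coercivity
`γ(Σ_i‖D_iu‖² + ‖u‖²) ≤ ⟨u, Δ_au⟩`, the local conjugation shape `⟨u,Λu⟩ − c_Λ‖u‖² ≤ ⟨wu, Λ(w⁻¹u)⟩` (p38's `conjM0_ge`) and the
kernel defect `≤ c_K‖u‖²` (§2), with `c_Λ + c_K ≤ γ/2`:  `(γ/2)(Σ_i‖D_iu‖² + ‖u‖²) ≤ ⟨wu, Δ_a(w⁻¹u)⟩`.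
[cite: Balaban1984PropagatorsI, p.36 («e^{−⟨q,x⟩}Δ_a e^{⟨q,x⟩} − Δ_a is a small perturbation of Δ_a»), (1.90) p.33, (1.69) p.29] -/
theorem conj_form_ge {ι : Type*} [Fintype ι] (Δa Λ K : Matrix X X ℝ) (hΔ : Δa = Λ - K) (D : ι → Matrix X X ℝ)
    {γ : ℝ} (hγ : 0 ≤ γ) (hco : ∀ u : X → ℝ, γ * ((∑ i, ∑ x, (D i *ᵥ u) x ^ 2) + ∑ x, u x ^ 2) ≤ u ⬝ᵥ (Δa *ᵥ u))
    (w : X → ℝ) {cΛ cK : ℝ}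
    (hΛ : ∀ u : X → ℝ, u ⬝ᵥ (Λ *ᵥ u) - cΛ * ∑ x, u x ^ 2 ≤
      (fun x => w x * u x) ⬝ᵥ (Λ *ᵥ fun x => (w x)⁻¹ * u x))
    (hKc : ∀ u : X → ℝ, |(fun x => w x * u x) ⬝ᵥ (K *ᵥ fun x => (w x)⁻¹ * u x) - u ⬝ᵥ (K *ᵥ u)| ≤
      cK * ∑ x, u x ^ 2)
    (hsmall : cΛ + cK ≤ γ / 2) (u : X → ℝ) :
    γ / 2 * ((∑ i, ∑ x, (D i *ᵥ u) x ^ 2) + ∑ x, u x ^ 2) ≤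
      (fun x => w x * u x) ⬝ᵥ (Δa *ᵥ fun x => (w x)⁻¹ * u x) := by
  have h1 := hco u
  have h2 := hΛ u
  have h3 := (abs_le.mp (hKc u)).2
  have hdir : 0 ≤ ∑ i, ∑ x, (D i *ᵥ u) x ^ 2 :=
    Finset.sum_nonneg fun _ _ => Finset.sum_nonneg fun _ _ => sq_nonneg _
  have hu : 0 ≤ ∑ x, u x ^ 2 := Finset.sum_nonneg fun _ _ => sq_nonneg _
  have hsplit : (fun x => w x * u x) ⬝ᵥ (Δa *ᵥ fun x => (w x)⁻¹ * u x)
      = (fun x => w x * u x) ⬝ᵥ (Λ *ᵥ fun x => (w x)⁻¹ * u x)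
        - (fun x => w x * u x) ⬝ᵥ (K *ᵥ fun x => (w x)⁻¹ * u x) := by
    rw [hΔ, Matrix.sub_mulVec, dotProduct_sub]
  have hsplit0 : u ⬝ᵥ (Δa *ᵥ u) = u ⬝ᵥ (Λ *ᵥ u) - u ⬝ᵥ (K *ᵥ u) := by
    rw [hΔ, Matrix.sub_mulVec, dotProduct_sub]
  rw [hsplit]
  rw [hsplit0] at h1
  -- γ(dir + nsq) ≤ ⟨u,Λu⟩ − ⟨u,Ku⟩ ≤ conj + (cΛ + cK) nsq ≤ conj + (γ/2) nsq
  set dir := ∑ i, ∑ x, (D i *ᵥ u) x ^ 2 with hdir_def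
  set nsq := ∑ x, u x ^ 2 with hnsq_def
  have e1 : γ * (dir + nsq) = γ * dir + γ * nsq := by ring
  have e2 : γ / 2 * (dir + nsq) = γ / 2 * dir + γ / 2 * nsq := by ring
  have h4 : (cΛ + cK) * nsq ≤ γ / 2 * nsq := mul_le_mul_of_nonneg_right hsmall hu
  have e3 : (cΛ + cK) * nsq = cΛ * nsq + cK * nsq := by ring
  have h5 : 0 ≤ γ / 2 * dir := mul_nonneg (by linarith) hdir
  linarith

/-- **THE WEIGHTED SOLVE FOR `Δ_a = Λ − K`** (p38's `solve_bound` with the non-local term): under the hypotheses of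
`conj_form_ge` with `γ > 0`, for every source `g`, with `v = Gg` (`Δ_aG = 1`) and the weighted solution `u = wv`:
`Σ_i Σ_x (D_iu)(x)² + Σ_x u(x)² ≤ (2/γ)²·Σ_x (w(x)g(x))²`.
[cite: Balaban1984PropagatorsI, p.36 («e^{−⟨q,x⟩}Δ_a e^{⟨q,x⟩} − Δ_a is a small perturbation of Δ_a for vectors q ∈ R^d sufficiently small»), (1.90) p.33] -/
theorem weighted_solve {ι : Type*} [Fintype ι] (Δa Λ K : Matrix X X ℝ) (hΔ : Δa = Λ - K) (D : ι → Matrix X X ℝ)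
    {γ : ℝ} (hγ : 0 < γ)
    (hco : ∀ u : X → ℝ, γ * ((∑ i, ∑ x, (D i *ᵥ u) x ^ 2) + ∑ x, u x ^ 2) ≤ u ⬝ᵥ (Δa *ᵥ u))
    (w : X → ℝ) (hw : ∀ x, w x ≠ 0) {cΛ cK : ℝ}
    (hΛ : ∀ u : X → ℝ, u ⬝ᵥ (Λ *ᵥ u) - cΛ * ∑ x, u x ^ 2 ≤
      (fun x => w x * u x) ⬝ᵥ (Λ *ᵥ fun x => (w x)⁻¹ * u x))
    (hKc : ∀ u : X → ℝ, |(fun x => w x * u x) ⬝ᵥ (K *ᵥ fun x => (w x)⁻¹ * u x) - u ⬝ᵥ (K *ᵥ u)| ≤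
      cK * ∑ x, u x ^ 2)
    (hsmall : cΛ + cK ≤ γ / 2) (G : Matrix X X ℝ) (hG : Δa * G = 1) (g : X → ℝ) :
    (∑ i, ∑ x, (D i *ᵥ fun y => w y * (G *ᵥ g) y) x ^ 2) + ∑ x, (w x * (G *ᵥ g) x) ^ 2
      ≤ (2 / γ) ^ 2 * ∑ x, (w x * g x) ^ 2 := by
  set v := G *ᵥ g with hv
  set u : X → ℝ := fun y => w y * v y with hu
  have hΔv : Δa *ᵥ v = g := by rw [hv, Matrix.mulVec_mulVec, hG, Matrix.one_mulVec]
  -- the conjugated form evaluated at u: ⟨wu, Δa(w⁻¹u)⟩ = ⟨u, wg⟩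
  have hinv : (fun x => (w x)⁻¹ * u x) = v := by
    funext x; simp only [hu]; rw [← mul_assoc, inv_mul_cancel₀ (hw x), one_mul]
  have heval : (fun x => w x * u x) ⬝ᵥ (Δa *ᵥ fun x => (w x)⁻¹ * u x) = u ⬝ᵥ fun x => w x * g x := by
    rw [hinv, hΔv]
    simp only [dotProduct, hu]
    exact Finset.sum_congr rfl fun x _ => by ring
  have hform := conj_form_ge Δa Λ K hΔ D hγ.le hco w hΛ hKc hsmall u
  rw [heval] at hform
  set E := (∑ i, ∑ x, (D i *ᵥ u) x ^ 2) + ∑ x, u x ^ 2 with hE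
  have hdir : 0 ≤ ∑ i, ∑ x, (D i *ᵥ u) x ^ 2 :=
    Finset.sum_nonneg fun _ _ => Finset.sum_nonneg fun _ _ => sq_nonneg _
  have hnu : 0 ≤ ∑ x, u x ^ 2 := Finset.sum_nonneg fun _ _ => sq_nonneg _
  have hE0 : 0 ≤ E := add_nonneg hdir hnu
  have hN0 : 0 ≤ ∑ x, (w x * g x) ^ 2 := Finset.sum_nonneg fun _ _ => sq_nonneg _
  -- ⟨u, wg⟩ ≤ √(Σu²)√N ≤ √E √N
  have hcs : (u ⬝ᵥ fun x => w x * g x) ≤ Real.sqrt E * Real.sqrt (∑ x, (w x * g x) ^ 2) := by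
    refine (dot_le_sqrt_mul_sqrt u _).trans ?_
    exact mul_le_mul_of_nonneg_right (Real.sqrt_le_sqrt (by linarith)) (Real.sqrt_nonneg _)
  have hmain : γ / 2 * E ≤ Real.sqrt E * Real.sqrt (∑ x, (w x * g x) ^ 2) := hform.trans hcs
  have := le_of_half_gamma_mul_le hγ hE0 hN0 hmain
  simpa only [hE, hu] using this

end Solve

/-! ## §4 Localisation: from the weighted bound to the decay between cubes -/

section Local

variable {X : Type*} [Fintype X]

omit [Fintype X] in
/-- if the exponent vanishes on the support of the source, the weighted source is the source: `e^{δρ}g = g`.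
[cite: Balaban1984PropagatorsI, (1.114) p.36 («for supp ζ ⊂ Δ̃(y), supp J ⊂ Δ̃(y′)»)] -/
theorem weight_mul_eq_self (ρ : X → ℝ) (δ : ℝ) (g : X → ℝ) (hg : ∀ x, g x ≠ 0 → ρ x = 0) :
    (fun x => Real.exp (δ * ρ x) * g x) = g := by
  funext x
  by_cases h : g x = 0
  · simp [h]
  · rw [hg x h, mul_zero, Real.exp_zero, one_mul]

/-- **extraction of the decay**: on the set `{ρ ≥ R}`, `Σ v² ≤ e^{−2δR}·Σ_x (e^{δρ(x)}v(x))²` (δ ≥ 0).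
[cite: Balaban1984PropagatorsI, (1.114) p.36 («≤ O(1)e^{−δ₀|y−y′|} …»)] -/
theorem sum_sq_filter_le_exp (ρ : X → ℝ) {δ : ℝ} (hδ : 0 ≤ δ) (R : ℝ)
    [DecidablePred fun x => R ≤ ρ x] (v : X → ℝ) :
    ∑ x ∈ Finset.univ.filter (fun x => R ≤ ρ x), v x ^ 2 ≤
      Real.exp (-(2 * δ * R)) * ∑ x, (Real.exp (δ * ρ x) * v x) ^ 2 := by
  have hterm : ∀ x ∈ Finset.univ.filter (fun x => R ≤ ρ x),
      v x ^ 2 ≤ Real.exp (-(2 * δ * R)) * (Real.exp (δ * ρ x) * v x) ^ 2 := by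
    intro x hx
    have hR : R ≤ ρ x := (Finset.mem_filter.mp hx).2
    have hexp : 1 ≤ Real.exp (-(2 * δ * R)) * Real.exp (δ * ρ x) ^ 2 := by
      rw [← Real.exp_nat_mul, ← Real.exp_add]
      exact Real.one_le_exp (by push_cast; nlinarith)
    calc v x ^ 2 = 1 * v x ^ 2 := (one_mul _).symm
      _ ≤ (Real.exp (-(2 * δ * R)) * Real.exp (δ * ρ x) ^ 2) * v x ^ 2 :=
          mul_le_mul_of_nonneg_right hexp (sq_nonneg _)
      _ = Real.exp (-(2 * δ * R)) * (Real.exp (δ * ρ x) * v x) ^ 2 := by ring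
  calc ∑ x ∈ Finset.univ.filter (fun x => R ≤ ρ x), v x ^ 2
      ≤ ∑ x ∈ Finset.univ.filter (fun x => R ≤ ρ x), Real.exp (-(2 * δ * R)) * (Real.exp (δ * ρ x) * v x) ^ 2 :=
        Finset.sum_le_sum hterm
    _ ≤ ∑ x, Real.exp (-(2 * δ * R)) * (Real.exp (δ * ρ x) * v x) ^ 2 :=
        Finset.sum_le_sum_of_subset_of_nonneg (Finset.filter_subset _ _)
          (fun x _ _ => mul_nonneg (Real.exp_pos _).le (sq_nonneg _))
    _ = Real.exp (-(2 * δ * R)) * ∑ x, (Real.exp (δ * ρ x) * v x) ^ 2 := by rw [Finset.mul_sum]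

/-- **THE n = 0 MEMBER SHAPE OF (1.114) FROM THE WEIGHTED SOLVE**: if `ρ ≥ 0`… no sign needed — if `ρ` vanishes on supp g
and the weighted solve gives `Σ(e^{δρ}Gg)² ≤ B·Σ(e^{δρ}g)²`, then on `{ρ ≥ R}`: `Σ (Gg)² ≤ e^{−2δR}·B·Σ g²`.
[cite: Balaban1984PropagatorsI, (1.114) p.36, p.36 («e^{−⟨q,x⟩}Δ_a e^{⟨q,x⟩} …»)] -/
theorem local_decay (ρ : X → ℝ) {δ : ℝ} (hδ : 0 ≤ δ) (R : ℝ) [DecidablePred fun x => R ≤ ρ x] (v g : X → ℝ)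
    (hg : ∀ x, g x ≠ 0 → ρ x = 0) {B : ℝ}
    (hB : ∑ x, (Real.exp (δ * ρ x) * v x) ^ 2 ≤ B * ∑ x, (Real.exp (δ * ρ x) * g x) ^ 2) :
    ∑ x ∈ Finset.univ.filter (fun x => R ≤ ρ x), v x ^ 2 ≤ Real.exp (-(2 * δ * R)) * B * ∑ x, g x ^ 2 := by
  classical
  have h1 := sum_sq_filter_le_exp ρ hδ R v
  have hgw : ∑ x, (Real.exp (δ * ρ x) * g x) ^ 2 = ∑ x, g x ^ 2 :=
    Finset.sum_congr rfl fun x _ => by rw [congrFun (weight_mul_eq_self ρ δ g hg) x]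
  rw [hgw] at hB
  calc ∑ x ∈ Finset.univ.filter (fun x => R ≤ ρ x), v x ^ 2
      ≤ Real.exp (-(2 * δ * R)) * ∑ x, (Real.exp (δ * ρ x) * v x) ^ 2 := h1
    _ ≤ Real.exp (-(2 * δ * R)) * (B * ∑ x, g x ^ 2) := mul_le_mul_of_nonneg_left hB (Real.exp_pos _).le
    _ = Real.exp (-(2 * δ * R)) * B * ∑ x, g x ^ 2 := by ring

end Local

/-! ## §5 The tower instance: `Δ_a = M0 − K` on p37's carrier, one component -/

section Tower

open B1RG242Torus B5Ineq137Torus B5Eq133G0Torus B5G0SettingTorus B5CombesThomasTorus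

variable {P : Params} {k : ℕ}

/-- **THE WEIGHTED SOLVE FOR `Δ_a = M0 − K` ON THE TOWER** (one component μ; `M0 = −Δ^η + (Lᵏε)²m² + aQ*_μQ_μ` is p37's
operator, `K` any symmetric kernel with a `distX`-row profile `Σ_{x′}|K(x,x′)|·|x−x′|e^{δ₁|x−x′|} ≤ S` — the shape of (1.126)
for `∂P∂*`; `Δ_a := M0 − K` coercive in the (1.90) shape): for `4δ ≤ 1`, `δ ≤ δ₁`, `(2d + 16a)δ² + δS ≤ γ/2`, every source `g`,
`v = Gg` (`Δ_aG = 1`), `u = e^{δρ}v`:  `Σ_μ‖∂_μu‖² + ‖u‖² ≤ (2/γ)²‖e^{δρ}g‖²` — p38's `solve_bound` with the non-local term,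
the local half being `conjM0_ge` BY NAME. [cite: Balaban1984PropagatorsI, p.36 («e^{−⟨q,x⟩}Δ_a e^{⟨q,x⟩} − Δ_a is a small perturbation of Δ_a»), (1.69) p.29, (1.90) p.33, (1.126) p.38] -/
theorem solve_bound_kernel {ρ : Site P 0 → ℝ} (hρ : LipX P k ρ) (hk : k ≤ P.m + P.K) {a msq : ℝ} (ha : 0 ≤ a)
    (μ : Fin P.d) (K : Matrix (Site P 0) (Site P 0) ℝ) (hK : K.IsSymm) {δ₁ S : ℝ}
    (hS : ∀ x, ∑ x', |K x x'| * (distX P k x x' * Real.exp (δ₁ * distX P k x x')) ≤ S)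
    {γ : ℝ} (hγ : 0 < γ)
    (hco : ∀ f : Site P 0 → ℝ, γ * (f ⬝ᵥ ((lapEta P k + 1) *ᵥ f)) ≤ f ⬝ᵥ ((M0 P a msq k μ - K) *ᵥ f))
    {δ : ℝ} (hδ0 : 0 ≤ δ) (hδ4 : 4 * δ ≤ 1) (hδ1 : δ ≤ δ₁)
    (hsmall : (2 * P.d + 16 * a) * δ ^ 2 + δ * S ≤ γ / 2)
    (G : Matrix (Site P 0) (Site P 0) ℝ) (hG : (M0 P a msq k μ - K) * G = 1) (g : Site P 0 → ℝ) :
    dirE P k (pmul (wt P δ ρ) (G *ᵥ g)) + nsq P (pmul (wt P δ ρ) (G *ᵥ g))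
      ≤ (2 / γ) ^ 2 * nsq P (pmul (wt P δ ρ) g) := by
  -- the generic solve with Λ = M0, D = the η-derivatives, w = e^{δρ}
  have hco' : ∀ u : Site P 0 → ℝ,
      γ * ((∑ ν, ∑ x, (deriv P 0 ((P.L : ℝ) ^ k)⁻¹ ν *ᵥ u) x ^ 2) + ∑ x, u x ^ 2)
        ≤ u ⬝ᵥ ((M0 P a msq k μ - K) *ᵥ u) := by
    intro u
    have h := hco u
    rw [form_lapEta_add_one] at h
    exact h
  have hΛ : ∀ u : Site P 0 → ℝ, u ⬝ᵥ (M0 P a msq k μ *ᵥ u) - (2 * P.d + 16 * a) * δ ^ 2 * ∑ x, u x ^ 2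
      ≤ (fun x => wt P δ ρ x * u x) ⬝ᵥ (M0 P a msq k μ *ᵥ fun x => (wt P δ ρ x)⁻¹ * u x) := by
    intro u
    exact conjM0_ge hρ hk ha hδ0 hδ4 msq μ u
  have hdX : ∀ x x' : Site P 0, distX P k x x' = distX P k x' x := by
    intro x x'; unfold distX; rw [T_symm P 0 x x']
  have hKc : ∀ u : Site P 0 → ℝ,
      |(fun x => wt P δ ρ x * u x) ⬝ᵥ (K *ᵥ fun x => (wt P δ ρ x)⁻¹ * u x) - u ⬝ᵥ (K *ᵥ u)|
        ≤ δ * S * ∑ x, u x ^ 2 := by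
    intro u
    exact kernel_conj_defect_le K hK (distX P k) hdX ρ hρ hδ0 hδ1 hS u
  have hsmall' : (2 * P.d + 16 * a) * δ ^ 2 + δ * S ≤ γ / 2 := hsmall
  have h := weighted_solve (M0 P a msq k μ - K) (M0 P a msq k μ) K rfl
    (fun ν => deriv P 0 ((P.L : ℝ) ^ k)⁻¹ ν) hγ hco' (wt P δ ρ) (wt_ne_zero δ ρ) hΛ hKc hsmall' G hG g
  exact h

/-- **THE n = 0 MEMBER SHAPE OF (1.114) FOR `Δ_a = M0 − K` ON THE TOWER**: with `ρ ≥ 0` vanishing on the support of `g`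
(e.g. `ρ = dist(·, Δ̃(y′))`), on `{ρ ≥ R}`:  `Σ (Gg)² ≤ e^{−2δR}(2/γ)²·Σ g²`.
[cite: Balaban1984PropagatorsI, (1.114) p.36 («‖ζGJ‖ ≤ O(1)e^{−δ₀|y−y′|}|ζ| ‖J‖ for supp ζ ⊂ Δ̃(y), supp J ⊂ Δ̃(y′)»), p.36 (the route)] -/
theorem local_decay_kernel {ρ : Site P 0 → ℝ} (hρ : LipX P k ρ) (hk : k ≤ P.m + P.K) {a msq : ℝ} (ha : 0 ≤ a)
    (μ : Fin P.d) (K : Matrix (Site P 0) (Site P 0) ℝ) (hK : K.IsSymm) {δ₁ S : ℝ}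
    (hS : ∀ x, ∑ x', |K x x'| * (distX P k x x' * Real.exp (δ₁ * distX P k x x')) ≤ S)
    {γ : ℝ} (hγ : 0 < γ)
    (hco : ∀ f : Site P 0 → ℝ, γ * (f ⬝ᵥ ((lapEta P k + 1) *ᵥ f)) ≤ f ⬝ᵥ ((M0 P a msq k μ - K) *ᵥ f))
    {δ : ℝ} (hδ0 : 0 ≤ δ) (hδ4 : 4 * δ ≤ 1) (hδ1 : δ ≤ δ₁)
    (hsmall : (2 * P.d + 16 * a) * δ ^ 2 + δ * S ≤ γ / 2)
    (G : Matrix (Site P 0) (Site P 0) ℝ) (hG : (M0 P a msq k μ - K) * G = 1) (g : Site P 0 → ℝ)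
    (hg : ∀ x, g x ≠ 0 → ρ x = 0) (R : ℝ) [DecidablePred fun x => R ≤ ρ x] :
    ∑ x ∈ Finset.univ.filter (fun x => R ≤ ρ x), (G *ᵥ g) x ^ 2
      ≤ Real.exp (-(2 * δ * R)) * (2 / γ) ^ 2 * ∑ x, g x ^ 2 := by
  have h := solve_bound_kernel hρ hk ha μ K hK hS hγ hco hδ0 hδ4 hδ1 hsmall G hG g
  have hB : ∑ x, (Real.exp (δ * ρ x) * (G *ᵥ g) x) ^ 2 ≤ (2 / γ) ^ 2 * ∑ x, (Real.exp (δ * ρ x) * g x) ^ 2 := by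
    have hdir : 0 ≤ dirE P k (pmul (wt P δ ρ) (G *ᵥ g)) :=
      Finset.sum_nonneg fun _ _ => Finset.sum_nonneg fun _ _ => sq_nonneg _
    have h2 : nsq P (pmul (wt P δ ρ) (G *ᵥ g)) ≤ (2 / γ) ^ 2 * nsq P (pmul (wt P δ ρ) g) := by linarith
    simpa only [nsq, pmul_apply, wt] using h2
  exact local_decay ρ hδ0 R (G *ᵥ g) g hg hB

end Tower

end

end Literature.MathematicalPhysics.QuantumFieldTheory.Balaban1983to89.B5CombesThomasKernel
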